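import Literature.NumberTheory.Transcendental.KZGroundingRelations

/-!
# `GenusTwoRealPeriodCell` (stmt-KontsevichZagierPeriods-17657), line `Sketch` — stub `stub_telescope`

**Telescoping over the bands of an open interval.** In the engine of the line (Newton–Leibniz down
a band), over a base point `x` the open fibre `(u, v)` of the band is, by an adapted cylindrical
decomposition, a FINITE set `E` of section values union the open INNER bands
`(ξ_{j-1} x, ξ_j x)`, `j ∈ B`, of a strictly increasing finite sequence of sections `ξ`. One
Newton–Leibniz move per band yields the base integrands `g (ξ_j x) − g (ξ_{j-1} x)`; this file
proves that their sum over `B` is `g v − g u` (`stub_telescope`, registered signature).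

Proof: induction on `B.card`, for all `u ≤ v`, from the two inclusions
`(u, v) ⊆ E ∪ ⋃_{j ∈ B} (lo j, hi j)` and `(lo j, hi j) ⊆ (u, v)` (`j ∈ B`), where the bands are
nonempty (`lo j < hi j`) and separated (`hi j ≤ lo j'` for `j < j'`). If `B = ∅` then `(u, v) ⊆ E`
is finite, so `u = v` and both sides vanish. Otherwise let `j₁` be the least element of `B`.
Its band lies in `(u, v)`, so `u ≤ lo j₁` and `hi j₁ ≤ v`; and `lo j₁ ≤ u`, for otherwise the
infinite interval `(u, min v (lo j₁))` would lie in `(u, v)` and meet no band (all bands start at or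
above `lo j₁`), hence lie in the finite set `E`. So `lo j₁ = u`, and the data
`(hi j₁, v, B ∖ {j₁}, E)` satisfy the same two inclusions (a point of `(hi j₁, v)` in the band `j₁`
is impossible; the other bands start at or above `hi j₁`), whence
`∑_B = (g (hi j₁) − g u) + (g v − g (hi j₁)) = g v − g u`.

References: M. Kontsevich, D. Zagier, *Periods* (2001), §1.2, rule (3) (context only);
S. Basu, R. Pollack, M.-F. Roy, *Algorithms in Real Algebraic Geometry* (2006), Def. 5.1 (bands).
No definition, no named fact.
-/

noncomputable section

open scoped BigOperators
open Set MeasureTheory Filter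
open Literature.NumberTheory.Transcendental
open Literature.ModelTheory.ExponentialFields (IsSemialgebraic IsCylindricalDecomposition graphOver
  bandOver bandLower bandUpper bandLower_of_ne_zero bandUpper_of_ne_last)

namespace Summit.KontsevichZagierPeriods.IsogenyCertificates.GenusTwoRealPeriodCellLine

/-! ## Telescoping over separated open intervals tiling an interval up to a finite set -/

/-- **Abstract telescoping.** Let `(lo j, hi j)`, `j ∈ B`, be nonempty open intervals indexed by a
finite subset of a linear order, separated in order (`hi j ≤ lo j'` for `j < j'` in `B`), all
contained in `(u, v)` (`u ≤ v`) and covering it up to a finite set `E`. Then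
`∑_{j ∈ B} (g (hi j) − g (lo j)) = g v − g u`. (Induction on `B.card`, peeling off the least band,
whose lower end must be `u`.) [folklore] -/
theorem telescope_sum_of_Ioo_subset {ι : Type*} [LinearOrder ι] (lo hi : ι → ℝ) (g : ℝ → ℝ)
    (v : ℝ) {E : Set ℝ} (hE : E.Finite) :
    ∀ (n : ℕ) (B : Finset ι), B.card = n → (∀ j ∈ B, lo j < hi j) →
    (∀ j ∈ B, ∀ j' ∈ B, j < j' → hi j ≤ lo j') →
    ∀ u : ℝ, u ≤ v → Ioo u v ⊆ E ∪ ⋃ j ∈ B, Ioo (lo j) (hi j) →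
    (∀ j ∈ B, Ioo (lo j) (hi j) ⊆ Ioo u v) →
    ∑ j ∈ B, (g (hi j) - g (lo j)) = g v - g u := by
  intro n
  induction n with
  | zero =>
    intro B hcard _ _ u huv hcov _
    rw [Finset.card_eq_zero] at hcard
    subst hcard
    -- `(u, v) ⊆ E` is finite, so `u = v`
    have hfin : (Ioo u v).Finite := hE.subset fun t ht => by
      rcases hcov ht with h | h
      · exact h
      · simp at h
    have hvu : v ≤ u := not_lt.1 fun h => Set.Ioo_infinite h hfin
    rw [Finset.sum_empty, le_antisymm huv hvu, sub_self]
  | succ n ih =>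
    intro B hcard hlt hsep u huv hcov hsub
    have hne : B.Nonempty := Finset.card_pos.1 (by omega)
    -- the least band `j₁`
    obtain ⟨j₁, hj₁B, hmin⟩ : ∃ j₁ ∈ B, ∀ j ∈ B, j₁ ≤ j :=
      ⟨B.min' hne, Finset.min'_mem B hne, fun j hj => Finset.min'_le B j hj⟩
    have hlt₁ : lo j₁ < hi j₁ := hlt j₁ hj₁B
    -- its band lies in `(u, v)`: `u ≤ lo j₁` and `hi j₁ ≤ v`
    obtain ⟨hul, hhv⟩ := (Set.Ioo_subset_Ioo_iff hlt₁).1 (hsub j₁ hj₁B)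
    -- every band of `B` starts at or above `lo j₁`
    have hlo : ∀ j ∈ B, lo j₁ ≤ lo j := by
      intro j hj
      rcases (hmin j hj).lt_or_eq with h | h
      · exact hlt₁.le.trans (hsep j₁ hj₁B j hj h)
      · rw [h]
    -- `lo j₁ ≤ u`: otherwise `(u, min v (lo j₁))` is infinite, inside `(u, v)`, and band-free
    have hlu : lo j₁ ≤ u := by
      refine not_lt.1 fun h => ?_
      have huv' : u < min v (lo j₁) := lt_min ((h.trans hlt₁).trans_le hhv) h
      refine Set.Ioo_infinite huv' (hE.subset fun t ht => ?_)
      obtain ⟨htu, htm⟩ := ht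
      obtain ⟨htv, htl⟩ := lt_min_iff.1 htm
      rcases hcov ⟨htu, htv⟩ with h' | h'
      · exact h'
      · exfalso
        obtain ⟨j, hj, hjt⟩ := mem_iUnion₂.1 h'
        exact lt_irrefl _ (((hlo j hj).trans_lt hjt.1).trans htl)
    have hu : lo j₁ = u := le_antisymm hlu hul
    -- peel off the band `j₁` and recurse on `(hi j₁, v)`
    have hcard' : (B.erase j₁).card = n := by
      rw [Finset.card_erase_of_mem hj₁B, hcard, Nat.add_sub_cancel]
    have key := ih (B.erase j₁) hcard' (fun j hj => hlt j (Finset.mem_of_mem_erase hj))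
      (fun j hj j' hj' hjj' =>
        hsep j (Finset.mem_of_mem_erase hj) j' (Finset.mem_of_mem_erase hj') hjj')
      (hi j₁) hhv ?_ ?_
    · rw [← Finset.add_sum_erase B _ hj₁B, key, hu]
      ring
    · -- `(hi j₁, v) ⊆ E ∪ ⋃_{j ∈ B ∖ {j₁}} (lo j, hi j)`
      intro t ht
      have ht' : t ∈ Ioo u v := ⟨(hul.trans_lt hlt₁).trans ht.1, ht.2⟩
      rcases hcov ht' with h | h
      · exact mem_union_left _ h
      · refine mem_union_right _ ?_
        obtain ⟨j, hj, hjt⟩ := mem_iUnion₂.1 h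
        refine mem_iUnion₂.2 ⟨j, Finset.mem_erase.2 ⟨fun heq => ?_, hj⟩, hjt⟩
        rw [heq] at hjt
        exact lt_irrefl _ (hjt.2.trans ht.1)
    · -- the other bands lie in `(hi j₁, v)`
      intro j hj t ht
      obtain ⟨hne', hjB⟩ := Finset.mem_erase.1 hj
      have hlt' : j₁ < j := lt_of_le_of_ne (hmin j hjB) (Ne.symm hne')
      exact ⟨(hsep j₁ hj₁B j hjB hlt').trans_lt ht.1, (hsub j hjB ht).2⟩

/-! ## The stub -/

/-- **Telescoping over the bands of an open interval.** If the open interval `(u, v)` is, up to a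
finite set, the union of the inner bands `(ξ_{j-1}, ξ_j)`, `j ∈ B`, of a strictly increasing finite
sequence `ξ`, then `B` is a contiguous block reaching from `u` to `v`, so for every `g`,
`∑_{j ∈ B} (g ξ_j − g ξ_{j-1}) = g v − g u`. [folklore] -/
theorem stub_telescope : ∀ {m l : ℕ} (ξ : Fin l → (Fin m → ℝ) → ℝ) (x : Fin m → ℝ),
    (StrictMono fun i => ξ i x) → ∀ (B : Finset (Fin (l + 1))),
    (∀ j ∈ B, j ≠ 0 ∧ j ≠ Fin.last l) → ∀ (u v : ℝ), u < v → ∀ (E : Set ℝ), E.Finite →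
    Set.Ioo u v = E ∪ ⋃ j ∈ B, {t : ℝ | bandLower ξ j x < t ∧ (t : EReal) < bandUpper ξ j x} →
    ∀ g : ℝ → ℝ, ∑ j ∈ B, (g (bandUpper ξ j x).toReal - g (bandLower ξ j x).toReal) = g v - g u := by
  intro m l ξ x hmono B hB u v huv E hE hfib g
  -- the inner bands are the open intervals between their (finite) boundaries
  have hIoo : ∀ j ∈ B, {t : ℝ | bandLower ξ j x < t ∧ (t : EReal) < bandUpper ξ j x} =
      Ioo (bandLower ξ j x).toReal (bandUpper ξ j x).toReal :=
    fun j hj => KZ.bandFibre_eq_Ioo ξ (hB j hj).1 (hB j hj).2 x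
  -- nonempty
  have hlt : ∀ j ∈ B, (bandLower ξ j x).toReal < (bandUpper ξ j x).toReal :=
    fun j hj => KZ.toReal_bandLower_lt_toReal_bandUpper ξ hmono (hB j hj).1 (hB j hj).2
  -- separated
  have hsep : ∀ j ∈ B, ∀ j' ∈ B, j < j' → (bandUpper ξ j x).toReal ≤ (bandLower ξ j' x).toReal := by
    intro j hj j' hj' hjj'
    rw [bandUpper_of_ne_last ξ j (hB j hj).2, bandLower_of_ne_zero ξ j' (hB j' hj').1,
      EReal.toReal_coe, EReal.toReal_coe]
    exact hmono.monotone ((Fin.castPred_le_pred_iff (hB j hj).2 (hB j' hj').1).2 hjj')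
  -- covering `(u, v)` up to `E`
  have hcov : Ioo u v ⊆ E ∪ ⋃ j ∈ B, Ioo (bandLower ξ j x).toReal (bandUpper ξ j x).toReal := by
    intro t ht
    rw [hfib] at ht
    rcases ht with h | h
    · exact mem_union_left _ h
    · refine mem_union_right _ ?_
      obtain ⟨j, hj, hjt⟩ := mem_iUnion₂.1 h
      rw [hIoo j hj] at hjt
      exact mem_iUnion₂.2 ⟨j, hj, hjt⟩
  -- inside `(u, v)`
  have hsub : ∀ j ∈ B, Ioo (bandLower ξ j x).toReal (bandUpper ξ j x).toReal ⊆ Ioo u v := by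
    intro j hj t ht
    rw [← hIoo j hj] at ht
    rw [hfib]
    exact mem_union_right _ (mem_iUnion₂.2 ⟨j, hj, ht⟩)
  exact telescope_sum_of_Ioo_subset (fun j => (bandLower ξ j x).toReal)
    (fun j => (bandUpper ξ j x).toReal) g v hE B.card B rfl hlt hsep u huv.le hcov hsub

end Summit.KontsevichZagierPeriods.IsogenyCertificates.GenusTwoRealPeriodCellLine

end
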